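import Summits.QuantumFields.BalabanUV.Beta.D1BFx.PackedRoadRowsMassFlat

/-!
# `BalabanUV.Beta.D1BFx.PackedRoadRowsMassFlatRows` — road «BF-x» for binder row D1, slot (K): **«17-M♭ INPUT SPLIT», THE ROWS — PART 13∕14∕15's
# BLOCK LANE FROM THE SPLIT FIRST-JET INPUTS, AND THE SANDWICH LANE FROM THE ff PER-SLOT LETTER ALONE**

HONEST DEPENDENCY (cell records, verbatim): «continuum YM on T⁴ ⇐ BetaPertH ∧ nine spine estimates (0/9 proved); BetaPertH ⇐ (D1) ∧ (D4) ∧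
CAP+tail; G-an2-4 gates asym, D1 and NE2/3/4.»  HONEST FRAMING (cell contract, verbatim): «discharging `BetaPertH` makes Bałaban's UV stability
UNCONDITIONAL — a real constructive-QFT result; it is NOT the continuum limit and NOT the Clay problem.»  THIS MODULE DISCHARGES NOTHING of the
wall: [folklore] plumbing — `PackedRoadRowsMassFlat.jet_letters_mass_flat ∕ _tt` (the split (L1-M) inputs), the UNCHANGED pair façade
`PackedRoadRowsMass.table_letters_mass` ((L2-M) + (C2)) and this lineage's slot packs `RestKernelSlotRowsOn.exists_END_rows_Rk{Blk,Sand}_pow` BY NAME,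
modulo [B5] `h12`∕`h126` BY NAME exactly as in 17-M's façade.  No definition, no `def … : Prop`, no notation, nothing cited, 0 sorry.  0 root-level binders of
row D1 discharged (hW ∕ hR-sockets ∕ hSX-socket ∕ D1Tel ∕ D1Rep — 0); (K) NOT closed; NOT D1, NOT `BetaPertH`, NOT continuum, NOT Clay.

ABSOLUTE RULE (cell charter, verbatim): «No internally-minted statement may enter as a cited fact. Every hypothesis is either kernel-proved in
this package or a verbatim quotation of a PUBLISHED theorem with page reference. The manuscript(s) under audit are NOT citable for their own
disputed steps — they are the thing under adjudication; programme-internal (2001/route/tribunal) claims are never citable.»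

CONTENT (unit `b2b-balaban-beta-d1-formalise-leaf-01`, gen 27; INTENT-4; OWNER d1-p2 g22 W-2 ∕ ρ-g22-1 (b); an2 R-D1-g43-1 (M-b) ∕ R-D1-g43-3).
* `road_blk_rows_mass_flat` — 17-M's `PackedRoadRowsMass.road_blk_rows_mass` (PART 13∕14∕15's (i) `hMR` ∕ (ii) READING (b) `hRu` rows for
  `RkBlk a (Vroad a r S) (Wroad a r S₂)` on `n = Lc^k`, `k ≥ 1`) with the first-jet binders `{σS mS} hSs hSm` (ALL four blocks) REPLACED BY the split inputs of
  `jet_letters_mass_flat`: ff per slot `{σS} {mS : ℝ} hSs hSm`, the mm socket `hSmm`, the PACKED fm∕mf rows `{σP mP} hσVP hPs hPm`; the (L2-M)∕(C1)∕(C2)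
  binders and [B5] BY NAME unchanged; `CU′ := CUblk kG K c σV mV♭ κV mW` with
  `mV♭ j k′ := bif (j && k′) then 4·C_{G₀}·(1+16∕κ′)⁴·(mS + mT) else bif (j || k′) then mP j k′ else 0`, `κV`, `mW` verbatim 17-M.
* `road_sand_rows_mass_tt` — 17-M's `road_sand_rows_mass` (the SANDWICH lane `RkSand`) from the ff per-slot letter `hSs hSm` + (C1) ALONE on the first-jet
  side (17-M read only the `(tt)` instance of its all-blocks letter; the idle fm∕mf∕mm letters are no longer asked), pair side unchanged.
NOT HERE (honest): the (M-b) split of the PAIR letters `hBs hBm` (unchanged); the letters themselves; the END (the OWNER's, by generator on these rows).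
-/

noncomputable section

open Finset
open scoped BigOperators
open Literature.MathematicalPhysics.QuantumFieldTheory.Balaban1983to89
open Literature.MathematicalPhysics.QuantumFieldTheory.Balaban1983to89.Beta
open B12Sec2to5 (l1)
open B5Hk163Strip (kappa163)
open B5Hk163Decay (MG163)
open B4TorusKernel (periodConst)
open DecimatedMomentSummable (AbsMoment₂)
open ExpKernelCalculus (Site MKer BiLoc)
open OneStepResolventKernel (Fib)
open OneStepKernelFamily (KInvStep colH vertexOfK)
open AffineAveraging (box toSite)
open VectorTailsLoc (fam kfam)
open Summit.QuantumFields.BalabanUV.Beta.AxialDressingRooted (coDressKBmAt)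
open Summit.QuantumFields.BalabanUV.Beta.D1BFx.PackedKernelSplit (blk)
open Summit.QuantumFields.BalabanUV.Beta.D1BFx.PackedSortedBridges (embFF)
open Summit.QuantumFields.BalabanUV.Beta.D1BFx.FrozenLegTails (nOf MOf hn1)
open Summit.QuantumFields.BalabanUV.Beta.D1BFx.TorusWeightWordTwisted (tBw₁)
open Summit.QuantumFields.BalabanUV.Beta.D1BFx.PackedCoframePairLimit (cofPairInf)
open Summit.QuantumFields.BalabanUV.Beta.D1BFx.RestKernelSandwichSlot (RkSand CUsand)
open Summit.QuantumFields.BalabanUV.Beta.D1BFx.RestKernelBlockSlot (RkBlk CUblk)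
open Summit.QuantumFields.BalabanUV.Beta.D1BFx.RestKernelSlotRowsOn (exists_END_rows_RkSand_pow exists_END_rows_RkBlk_pow)
open Summit.QuantumFields.BalabanUV.Beta.D1BFx.PackedRoadTableRows (road_tableRate_pos)
open Summit.QuantumFields.BalabanUV.Beta.D1BFx.PackedRoadRestFamily (Vroad Wroad)
open Summit.QuantumFields.BalabanUV.Beta.D1BFx.PackedRoadRowsMass (table_letters_mass)
open Summit.QuantumFields.BalabanUV.Beta.D1BFx.PackedRoadRowsMassFlat (jet_letters_mass_flat jet_letters_mass_tt)

namespace Summit.QuantumFields.BalabanUV.Beta.D1BFx.PackedRoadRowsMassFlatRows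

section Rows

variable {Lc : ℕ} [NeZero Lc] {a : ℝ} (ha : 0 < a) {r : ℕ → Fin (3 + 1) → ℕ} {S : ℕ → Fin 4 → (Fin 4 → ℤ) → MKer 4 (Fib 3)}
  {S₂ : ℕ → Fin 4 → (Fin 4 → ℤ) → Fin 4 → (Fin 4 → ℤ) → MKer 4 (Fib 3)} {μ ν : Fin 4}
  {Ck δ₂ : ℕ → ℝ} {σS σP σV mS mT δ₀ κc : ℝ} {mP mB mC : Bool → Bool → ℝ}
include ha

/-- [folklore] **«ROAD ROWS FROM THE SPLIT MASS INPUTS» — THE BLOCK LANE**: PART 13∕14∕15's (i) `hMR` and (ii) READING (b) `hRu` (`Ru := 0`) for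
`RkBlk a (Vroad a r S) (Wroad a r S₂)` on `n = Lc^k`, `k ≥ 1`, from `2 ≤ Lc`, [B5] BY NAME, `hr`, the ff per-slot letter `hSs hSm` (`≤ mS`), the mm socket `hSmm`,
`0 < σV ≤ κ′∕16`, `σV ≤ σS`, (C1) `hTs hTm`, the PACKED fm∕mf rows `hPs hPm` at rate `σP∕Lc^k` (`σV ≤ σP`, `≤ mP j k′`), the per-scale pair socket `hS₂ hCk hδ₂`,
`0 < δ₀`, (L2-M) `hBs hBm`, `0 < κc`, (C2) `hCs′ hCm`; `CU′ := CUblk kG K c σV mV♭ κV mW`,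
`mV♭ j k := bif (j && k) then 4·C_{G₀}·(1+16∕κ′)⁴·(mS + mT) else bif (j || k) then mP j k else 0`, `κV := min (κ′∕8) (min (δ₀∕2) κc)`,
`mW j i := 16·C_{G₀}²·(1+16∕κ′)⁴·(1+4∕δ₀)⁴·mB j i + mC j i`. -/
theorem road_blk_rows_mass_flat (hL : 2 ≤ Lc) (h12 : B5.Prop12Printed (fam nOf hn1 MOf a ha)) (h126 : B5.Kernel126_127Printed (kfam nOf MOf))
    (hr : ∀ m : ℕ, r (m + 1) ∈ box (3 + 1) (m + 1))
    (hSs : ∀ (k : ℕ), 1 ≤ k → ∀ (κ : Fin 4) (u : Fin 4 → ℤ), Summable fun p : Site 4 × Site 4 =>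
      ∑ g, ∑ f, |blk (S (Lc ^ k) κ u) true true p.1 p.2 g f| * Real.exp (σS / ((Lc ^ k : ℕ) : ℝ) * (l1 (p.1 - u) + l1 (p.2 - u))))
    (hSm : ∀ (k : ℕ), 1 ≤ k → ∀ (κ : Fin 4) (u : Fin 4 → ℤ), ∑' p : Site 4 × Site 4,
      ∑ g, ∑ f, |blk (S (Lc ^ k) κ u) true true p.1 p.2 g f| * Real.exp (σS / ((Lc ^ k : ℕ) : ℝ) * (l1 (p.1 - u) + l1 (p.2 - u))) ≤ mS)
    (hSmm : ∀ (k : ℕ), 1 ≤ k → ∀ (κ : Fin 4) (u : Fin 4 → ℤ), blk (S (Lc ^ k) κ u) false false = 0)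
    (hσV : 0 < σV) (hσVκ : σV ≤ kappa163 4 / 4 / 16) (hσVσ : σV ≤ σS)
    (hTs : ∀ (k : ℕ), 1 ≤ k → ∀ (κ : Fin 4) (u : Fin 4 → ℤ), Summable fun p : Site 4 × Site 4 =>
      ∑ g, ∑ f, |tBw₁ (Lc ^ k) a κ u p.1 p.2 g f| * Real.exp (σV / ((Lc ^ k : ℕ) : ℝ) * (l1 (p.1 - u) + l1 (p.2 - u))))
    (hTm : ∀ (k : ℕ), 1 ≤ k → ∀ (κ : Fin 4) (u : Fin 4 → ℤ), ∑' p : Site 4 × Site 4,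
      ∑ g, ∑ f, |tBw₁ (Lc ^ k) a κ u p.1 p.2 g f| * Real.exp (σV / ((Lc ^ k : ℕ) : ℝ) * (l1 (p.1 - u) + l1 (p.2 - u))) ≤ mT)
    (hσVP : σV ≤ σP)
    (hPs : ∀ (k : ℕ), 1 ≤ k → ∀ (ρ : Fin 4) (y : Site 4) (j k' : Bool), j ≠ k' → Summable fun p : Site 4 × Site 4 => ∑ g, ∑ f,
      |blk (vertexOfK (coDressKBmAt (toSite (r (Lc ^ k))) (Lc ^ k) (KInvStep (d := 3) (Lc ^ k) 0)) (Lc ^ k) (S (Lc ^ k)) ρ y) j k' p.1 p.2 g f|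
        * Real.exp (σP / ((Lc ^ k : ℕ) : ℝ) * (l1 (p.1 - ((Lc ^ k : ℕ) : ℤ) • y) + l1 (p.2 - ((Lc ^ k : ℕ) : ℤ) • y))))
    (hPm : ∀ (k : ℕ), 1 ≤ k → ∀ (ρ : Fin 4) (y : Site 4) (j k' : Bool), j ≠ k' → ∑' p : Site 4 × Site 4, ∑ g, ∑ f,
      |blk (vertexOfK (coDressKBmAt (toSite (r (Lc ^ k))) (Lc ^ k) (KInvStep (d := 3) (Lc ^ k) 0)) (Lc ^ k) (S (Lc ^ k)) ρ y) j k' p.1 p.2 g f|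
        * Real.exp (σP / ((Lc ^ k : ℕ) : ℝ) * (l1 (p.1 - ((Lc ^ k : ℕ) : ℤ) • y) + l1 (p.2 - ((Lc ^ k : ℕ) : ℤ) • y))) ≤ mP j k')
    (hS₂ : ∀ n : ℕ, 2 ≤ n → ∀ κ u κ' u', BiLoc (S₂ n κ u κ' u') u u (Ck n * Real.exp (-δ₂ n * l1 (u' - u))) (δ₂ n))
    (hCk : ∀ n, 0 ≤ Ck n) (hδ₂ : ∀ n, 0 < δ₂ n) (hδ₀ : 0 < δ₀)
    (hBs : ∀ (k : ℕ), 1 ≤ k → ∀ (κ : Fin 4) (u : Fin 4 → ℤ) (κ' : Fin 4) (u' : Fin 4 → ℤ) (j i : Bool),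
      Summable fun p : Site 4 × Site 4 => ∑ g, ∑ f, |blk (S₂ (Lc ^ k) κ u κ' u') j i p.1 p.2 g f|)
    (hBm : ∀ (k : ℕ), 1 ≤ k → ∀ (κ : Fin 4) (u : Fin 4 → ℤ) (κ' : Fin 4) (u' : Fin 4 → ℤ) (j i : Bool),
      ∑' p : Site 4 × Site 4, ∑ g, ∑ f, |blk (S₂ (Lc ^ k) κ u κ' u') j i p.1 p.2 g f|
        ≤ mB j i * Real.exp (-(δ₀ / ((Lc ^ k : ℕ) : ℝ)) * l1 (u' - u)))
    (hκc : 0 < κc)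
    (hCs' : ∀ (k : ℕ), 1 ≤ k → ∀ (z : Site 4) (j i : Bool), Summable fun q : Site 4 × Site 4 => ∑ g, ∑ f,
      |blk (embFF (cofPairInf (Lc ^ k) a (colH (coDressKBmAt (toSite (r (Lc ^ k))) (Lc ^ k) (KInvStep (d := 3) (Lc ^ k) 0)) (Lc ^ k) μ 0)
        (colH (coDressKBmAt (toSite (r (Lc ^ k))) (Lc ^ k) (KInvStep (d := 3) (Lc ^ k) 0)) (Lc ^ k) ν z))) j i q.1 q.2 g f|)
    (hCm : ∀ (k : ℕ), 1 ≤ k → ∀ (z : Site 4) (j i : Bool), ∑' q : Site 4 × Site 4, ∑ g, ∑ f,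
      |blk (embFF (cofPairInf (Lc ^ k) a (colH (coDressKBmAt (toSite (r (Lc ^ k))) (Lc ^ k) (KInvStep (d := 3) (Lc ^ k) 0)) (Lc ^ k) μ 0)
        (colH (coDressKBmAt (toSite (r (Lc ^ k))) (Lc ^ k) (KInvStep (d := 3) (Lc ^ k) 0)) (Lc ^ k) ν z))) j i q.1 q.2 g f|
        ≤ mC j i * Real.exp (-κc * l1 z)) :
    ∃ kG K c : ℝ, 0 < c ∧ 0 ≤ kG ∧ 0 ≤ K ∧
      (∀ (u : (Bool × Bool) ⊕ (Bool × Bool × Bool × Bool)) (k : ℕ), 1 ≤ k → AbsMoment₂ (RkBlk a (Vroad a r S) (Wroad a r S₂) u (Lc ^ k) μ ν)) ∧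
      (∀ (u : (Bool × Bool) ⊕ (Bool × Bool × Bool × Bool)) (k : ℕ), 1 ≤ k →
        |B12Beta.secondMoment (RkBlk a (Vroad a r S) (Wroad a r S₂) u (Lc ^ k)) μ ν
          - (fun (_ : (Bool × Bool) ⊕ (Bool × Bool × Bool × Bool)) (_ : ℕ) => (0 : ℝ)) u (Lc ^ k)|
          ≤ CUblk kG K c σV (fun j k' => bif (j && k') then 4 * ((MG163 4 * periodConst (kappa163 4) 3) * (1 + 8 * (1 + Real.exp (kappa163 4 / 4)))
              * Real.exp (kappa163 4 / 4)) * (1 + 16 / (kappa163 4 / 4)) ^ 4 * (mS + mT) else bif (j || k') then mP j k' else 0)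
            (min (kappa163 4 / 4 / 8) (min (δ₀ / 2) κc))
            (fun j i => 16 * ((MG163 4 * periodConst (kappa163 4) 3) * (1 + 8 * (1 + Real.exp (kappa163 4 / 4))) * Real.exp (kappa163 4 / 4)) ^ 2
              * (1 + 16 / (kappa163 4 / 4)) ^ 4 * (1 + 4 / δ₀) ^ 4 * mB j i + mC j i) u) := by
  have hV := jet_letters_mass_flat (Lc := Lc) hr hSs hSm hSmm hσV.le hσVκ hσVσ hTs hTm hσVP hPs hPm
  have hW := table_letters_mass (Lc := Lc) (μ := μ) (ν := ν) hL hr hS₂ hCk hδ₂ hδ₀ hBs hBm hCs' hCm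
  have key := exists_END_rows_RkBlk_pow (Lc := Lc) (𝒱 := Vroad a r S) (𝒲 := Wroad a r S₂) (μ := μ) (ν := ν) ha h12 h126 hσV
    (fun k hk ρ y j k' => (hV k hk ρ y j k').1) (fun k hk ρ y j k' => (hV k hk ρ y j k').2) (road_tableRate_pos hδ₀ hκc)
    (fun k hk z j i => (hW k hk z j i).1) (fun k hk z j i => (hW k hk z j i).2)
  obtain ⟨kG, K, c, hc, hkG, hK, h1, h2, -⟩ := key
  exact ⟨kG, K, c, hc, hkG, hK, h1, h2⟩

/-- [folklore] **«ROAD ROWS FROM THE SPLIT MASS INPUTS» — THE SANDWICH LANE NEEDS ONLY THE ff PER-SLOT LETTER**: PART 13∕14∕15's (i)(ii) rows for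
`RkSand a (Vroad a r S) (Wroad a r S₂)` at every `Lc^k`, `k ≥ 1`, from the ff per-slot letter `hSs hSm` (`≤ mS`) + (C1) on the first-jet side (no mm socket, no
packed rows) and the unchanged pair side; `CU′ := CUsand kG K c σV (4·C_{G₀}·(1+16∕κ′)⁴·(mS + mT)) κV (16·C_{G₀}²·(1+16∕κ′)⁴·(1+4∕δ₀)⁴·mB tt tt + mC tt tt)`. -/
theorem road_sand_rows_mass_tt (hL : 2 ≤ Lc) (h12 : B5.Prop12Printed (fam nOf hn1 MOf a ha)) (h126 : B5.Kernel126_127Printed (kfam nOf MOf))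
    (hr : ∀ m : ℕ, r (m + 1) ∈ box (3 + 1) (m + 1))
    (hSs : ∀ (k : ℕ), 1 ≤ k → ∀ (κ : Fin 4) (u : Fin 4 → ℤ), Summable fun p : Site 4 × Site 4 =>
      ∑ g, ∑ f, |blk (S (Lc ^ k) κ u) true true p.1 p.2 g f| * Real.exp (σS / ((Lc ^ k : ℕ) : ℝ) * (l1 (p.1 - u) + l1 (p.2 - u))))
    (hSm : ∀ (k : ℕ), 1 ≤ k → ∀ (κ : Fin 4) (u : Fin 4 → ℤ), ∑' p : Site 4 × Site 4,
      ∑ g, ∑ f, |blk (S (Lc ^ k) κ u) true true p.1 p.2 g f| * Real.exp (σS / ((Lc ^ k : ℕ) : ℝ) * (l1 (p.1 - u) + l1 (p.2 - u))) ≤ mS)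
    (hσV : 0 < σV) (hσVκ : σV ≤ kappa163 4 / 4 / 16) (hσVσ : σV ≤ σS)
    (hTs : ∀ (k : ℕ), 1 ≤ k → ∀ (κ : Fin 4) (u : Fin 4 → ℤ), Summable fun p : Site 4 × Site 4 =>
      ∑ g, ∑ f, |tBw₁ (Lc ^ k) a κ u p.1 p.2 g f| * Real.exp (σV / ((Lc ^ k : ℕ) : ℝ) * (l1 (p.1 - u) + l1 (p.2 - u))))
    (hTm : ∀ (k : ℕ), 1 ≤ k → ∀ (κ : Fin 4) (u : Fin 4 → ℤ), ∑' p : Site 4 × Site 4,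
      ∑ g, ∑ f, |tBw₁ (Lc ^ k) a κ u p.1 p.2 g f| * Real.exp (σV / ((Lc ^ k : ℕ) : ℝ) * (l1 (p.1 - u) + l1 (p.2 - u))) ≤ mT)
    (hS₂ : ∀ n : ℕ, 2 ≤ n → ∀ κ u κ' u', BiLoc (S₂ n κ u κ' u') u u (Ck n * Real.exp (-δ₂ n * l1 (u' - u))) (δ₂ n))
    (hCk : ∀ n, 0 ≤ Ck n) (hδ₂ : ∀ n, 0 < δ₂ n) (hδ₀ : 0 < δ₀)
    (hBs : ∀ (k : ℕ), 1 ≤ k → ∀ (κ : Fin 4) (u : Fin 4 → ℤ) (κ' : Fin 4) (u' : Fin 4 → ℤ) (j i : Bool),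
      Summable fun p : Site 4 × Site 4 => ∑ g, ∑ f, |blk (S₂ (Lc ^ k) κ u κ' u') j i p.1 p.2 g f|)
    (hBm : ∀ (k : ℕ), 1 ≤ k → ∀ (κ : Fin 4) (u : Fin 4 → ℤ) (κ' : Fin 4) (u' : Fin 4 → ℤ) (j i : Bool),
      ∑' p : Site 4 × Site 4, ∑ g, ∑ f, |blk (S₂ (Lc ^ k) κ u κ' u') j i p.1 p.2 g f|
        ≤ mB j i * Real.exp (-(δ₀ / ((Lc ^ k : ℕ) : ℝ)) * l1 (u' - u)))
    (hκc : 0 < κc)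
    (hCs' : ∀ (k : ℕ), 1 ≤ k → ∀ (z : Site 4) (j i : Bool), Summable fun q : Site 4 × Site 4 => ∑ g, ∑ f,
      |blk (embFF (cofPairInf (Lc ^ k) a (colH (coDressKBmAt (toSite (r (Lc ^ k))) (Lc ^ k) (KInvStep (d := 3) (Lc ^ k) 0)) (Lc ^ k) μ 0)
        (colH (coDressKBmAt (toSite (r (Lc ^ k))) (Lc ^ k) (KInvStep (d := 3) (Lc ^ k) 0)) (Lc ^ k) ν z))) j i q.1 q.2 g f|)
    (hCm : ∀ (k : ℕ), 1 ≤ k → ∀ (z : Site 4) (j i : Bool), ∑' q : Site 4 × Site 4, ∑ g, ∑ f,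
      |blk (embFF (cofPairInf (Lc ^ k) a (colH (coDressKBmAt (toSite (r (Lc ^ k))) (Lc ^ k) (KInvStep (d := 3) (Lc ^ k) 0)) (Lc ^ k) μ 0)
        (colH (coDressKBmAt (toSite (r (Lc ^ k))) (Lc ^ k) (KInvStep (d := 3) (Lc ^ k) 0)) (Lc ^ k) ν z))) j i q.1 q.2 g f|
        ≤ mC j i * Real.exp (-κc * l1 z)) :
    ∃ kG K c : ℝ, 0 < c ∧ 0 ≤ kG ∧ 0 ≤ K ∧
      (∀ (u : Unit ⊕ (Bool × Bool)) (k : ℕ), 1 ≤ k → AbsMoment₂ (RkSand a (Vroad a r S) (Wroad a r S₂) u (Lc ^ k) μ ν)) ∧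
      (∀ (u : Unit ⊕ (Bool × Bool)) (k : ℕ), 1 ≤ k →
        |B12Beta.secondMoment (RkSand a (Vroad a r S) (Wroad a r S₂) u (Lc ^ k)) μ ν - (fun (_ : Unit ⊕ (Bool × Bool)) (_ : ℕ) => (0 : ℝ)) u (Lc ^ k)|
          ≤ CUsand kG K c σV (4 * ((MG163 4 * periodConst (kappa163 4) 3) * (1 + 8 * (1 + Real.exp (kappa163 4 / 4))) * Real.exp (kappa163 4 / 4))
              * (1 + 16 / (kappa163 4 / 4)) ^ 4 * (mS + mT))
            (min (kappa163 4 / 4 / 8) (min (δ₀ / 2) κc))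
            (16 * ((MG163 4 * periodConst (kappa163 4) 3) * (1 + 8 * (1 + Real.exp (kappa163 4 / 4))) * Real.exp (kappa163 4 / 4)) ^ 2
              * (1 + 16 / (kappa163 4 / 4)) ^ 4 * (1 + 4 / δ₀) ^ 4 * mB true true + mC true true) u) := by
  have hV := jet_letters_mass_tt (Lc := Lc) hr hSs hSm hσV.le hσVκ hσVσ hTs hTm
  have hW := table_letters_mass (Lc := Lc) (μ := μ) (ν := ν) hL hr hS₂ hCk hδ₂ hδ₀ hBs hBm hCs' hCm
  have key := exists_END_rows_RkSand_pow (Lc := Lc) (𝒱 := Vroad a r S) (𝒲 := Wroad a r S₂) (μ := μ) (ν := ν) ha h12 h126 hσV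
    (fun k hk ρ y => (hV k hk ρ y).1) (fun k hk ρ y => (hV k hk ρ y).2)
    (road_tableRate_pos hδ₀ hκc) (fun k hk z => (hW k hk z true true).1) (fun k hk z => (hW k hk z true true).2)
  obtain ⟨kG, K, c, hc, hkG, hK, h1, h2, -⟩ := key
  exact ⟨kG, K, c, hc, hkG, hK, h1, h2⟩

end Rows

end Summit.QuantumFields.BalabanUV.Beta.D1BFx.PackedRoadRowsMassFlatRows

end
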